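/-
# FILE U-0 — THE TWISTED RANK-ONE STAGE: THE BALL THRESHOLD BY FORMULA FROM ANY LEVEL OF THE POINT

★ `K2LiuRankOneStageTwistedBall.exists_twisted_family_ball` (F0P2-p11) exports, for the twisted rank-one stage `N s g` of the GK-cocycle road, the BALL
CLAUSE «for every `g` there is SOME threshold `k₀(g)` with `N s g = ∫_{x ∈ 𝔭^{−k}} conj ψ(σx)·Φ_s(w₀ u(x) g) dμ` for all `k ≥ k₀(g)`», the threshold chosen
inside its proof as `m(g) = max (m₀ g) (max (mψ − j)⁺ (j − mψ + 2·m₀ g + 1)⁺)` from a CHOSEN level `m₀ g` of `g` for `K′` (`g⁻¹ u(𝔭^{m₀}) g, g⁻¹ ū(𝔭^{m₀}) g ⊆ K′`)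
and `‖σ‖ = q^{−j}`.  The growth letter (b) `hk₀` of the K1-a♮ `hGnv` road (★ p864748, K1a desk WORD #37 «(β)+») needs that threshold BY FORMULA in terms of
data the consumer controls.  THIS FILE exports it: for EVERY level `m₀` of `g` for `K′` supplied by the caller and every `j` with `‖σ‖ = q^{−j}`, the SAME `N`
satisfies the ball clause for all `k ≥ M(m₀, j) := max m₀ (max (mψ − j)⁺ (j − mψ + 2m₀ + 1)⁺)` — because past ANY such threshold the ball integrals are
constant (★ `setIntegral_ball_twisted_eq_sum`: they all equal the coset sum at level `M`), and past ★'s own threshold they equal `N s g`.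
* §1 (fixed function) `setIntegral_ball_twisted_eq_setIntegral_of_level`: the ball integrals agree for all `k, k′ ≥ M(m₀, j)`;
* §2 (family) `exists_twisted_family_ball_of_level` (★'s three clauses VERBATIM + (iv) the ball clause past `M(m₀, j)` for every caller's level `m₀`) and
  `exists_twisted_family_ball_regular_of_level` (the same at every regular point, letters transferred by ★ `IsQRationalRegularAt.eq_of_eqOn_halfPlane`).

References: [cite: Casselman1980, §3 Thm. 3.1] [cite: CasselmanShalika1980, §2] [cite: Tate1950, §2.5] [cite: KudlaRallis1994, §2].
-/
import Summits.HodgeConjecture.HodgeConjecture.Theorems.K2LiuRankOneStageTwistedBall     -- ★ (F0P2-p11): `setIntegral_ball_twisted_eq_sum`, `exists_twisted_family_ball(_regular)`, the monomial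
import HarnessLib

set_option autoImplicit false
set_option linter.dupNamespace false -- the mandated namespace repeats `HodgeConjecture.HodgeConjecture`

noncomputable section

open MeasureTheory Filter Topology Set
open scoped NNReal ENNReal ComplexConjugate
open NumberField IsDedekindDomain
open Literature.NumberTheory.GaloisRepresentations.IsNonarchimedeanLocalField
open Literature.NumberTheory.Automorphic Literature.NumberTheory.Automorphic.LocalFieldHaar
open Summit.HodgeConjecture.HodgeConjecture.Cruxes.HLiu418.K2LiuQRationalDefs
open Summit.HodgeConjecture.HodgeConjecture.Cruxes.HLiu418.K2LiuRankOneStageTwistedBall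

namespace Summit.HodgeConjecture.HodgeConjecture.Cruxes.HLiu418.K2LiuRankOneStageTwistedBallLevel

/-! ## §1 Fixed function: past the threshold `M(m₀, j)` of ANY level `m₀`, the ball integrals agree -/

section Fixed

variable {K : Type} [Field K] [NumberField K] {w : HeightOneSpectrum (𝓞 K)} {G : Type*} [Group G]
variable [MeasurableSpace (w.adicCompletion K)] [BorelSpace (w.adicCompletion K)] (μ : Measure (w.adicCompletion K)) [μ.IsAddHaarMeasure]

omit [MeasurableSpace (w.adicCompletion K)] [BorelSpace (w.adicCompletion K)] in
/-- **the two thresholds of ★ `setIntegral_ball_twisted_eq_sum`, BY FORMULA.**  If `‖σ‖ = q^{−j}`, `ψ` has conductor exponent `mψ`, and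
`M := max m₀ (max (mψ − j)⁺ (j − mψ + 2m₀ + 1)⁺)`, then `ψ(σ·)` is trivial on `𝔭^{M}` (HEAD) and non-trivial somewhere on `𝔭^{2m₀ − M}` (TAIL).
(★'s proof, lines «the two thresholds», with `j` a binder.) [cite: Tate1950, §2.5] -/
theorem thresholds_of_level (ψ : AddChar (w.adicCompletion K) Circle) {mψ : ℤ} (hmψ : ψ.HasConductorExp mψ) {σ : w.adicCompletion K} {j : ℤ}
    (hj : normAbs (w.adicCompletion K) σ = (residueFieldCard (w.adicCompletion K) : ℝ≥0)⁻¹ ^ j) (m₀ : ℕ) :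
    (∀ t ∈ primePowBall (w.adicCompletion K) ((max m₀ (max (mψ - j).toNat (j - mψ + 2 * (m₀ : ℤ) + 1).toNat) : ℕ) : ℤ), ψ (σ * t) = 1) ∧
      ∃ t₀ ∈ primePowBall (w.adicCompletion K) (2 * (m₀ : ℤ) - ((max m₀ (max (mψ - j).toNat (j - mψ + 2 * (m₀ : ℤ) + 1).toNat) : ℕ) : ℤ)), ψ (σ * t₀) ≠ 1 := by
  have hq0 : (0 : ℝ≥0) < (residueFieldCard (w.adicCompletion K) : ℝ≥0)⁻¹ := inv_residueFieldCard_pos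
  set M : ℕ := max m₀ (max (mψ - j).toNat (j - mψ + 2 * (m₀ : ℤ) + 1).toNat) with hM
  have hhead : mψ - j ≤ (M : ℤ) := by
    have h1 : ((mψ - j).toNat : ℤ) ≤ (M : ℤ) := by exact_mod_cast (le_max_left _ _).trans (le_max_right m₀ _)
    exact (Int.self_le_toNat _).trans h1
  have htail : j - mψ + 2 * (m₀ : ℤ) + 1 ≤ (M : ℤ) := by
    have h1 : ((j - mψ + 2 * (m₀ : ℤ) + 1).toNat : ℤ) ≤ (M : ℤ) := by exact_mod_cast (le_max_right _ _).trans (le_max_right m₀ _)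
    exact (Int.self_le_toNat _).trans h1
  refine ⟨fun t ht => hmψ.1 _ ((mul_mem_primePowBall_iff hj).2 (primePowBall_antitone (by linarith) ht)), ?_⟩
  have hσout : σ ∉ primePowBall (w.adicCompletion K) (mψ - (2 * (m₀ : ℤ) - M)) := by
    rw [mem_primePowBall_iff, hj, not_le]
    exact (zpow_lt_zpow_iff_right_of_lt_one₀ hq0 inv_residueFieldCard_lt_one).2 (by linarith)
  obtain ⟨t₀, ht₀, hne⟩ := exists_mem_primePowBall_addChar_mul_ne_one hmψ hσout
  exact ⟨t₀, ht₀, by rwa [mul_comm] at hne⟩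

/-- **PAST THE THRESHOLD OF ANY LEVEL, THE BALL INTEGRALS OF THE TWISTED RANK-ONE STAGE AGREE** (fixed function, NO integrability).  In the letters of
★ `setIntegral_ball_twisted_eq_sum` (right-`K′`-invariant `f`, the `SL₂` relation `hrel`, ANY level `m₀` of `y` for `K′`), with `‖σ‖ = q^{−j}` and the conductor
exponent `mψ` of `ψ`: for all `k, k′ ≥ M(m₀, j) := max m₀ (max (mψ − j)⁺ (j − mψ + 2m₀ + 1)⁺)`,
`∫_{𝔭^{−k}} conj ψ(σx)·f(w₀ u(x) y) dμ = ∫_{𝔭^{−k′}} conj ψ(σx)·f(w₀ u(x) y) dμ` — both are the coset sum at level `M`. [cite: CasselmanShalika1980, §2] [cite: Tate1950, §2.5] -/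
theorem setIntegral_ball_twisted_eq_setIntegral_of_level {f : G → ℂ} {K' : Subgroup G} (hfK : ∀ g, ∀ k ∈ K', f (g * k) = f g)
    {u ū : w.adicCompletion K → G} (hu_add : ∀ x t, u (x + t) = u x * u t) (w₀ : G)
    (ν : (w.adicCompletion K)ˣ →* ℂˣ) (e C₀ : ℂ)
    (hrel : ∀ (x : (w.adicCompletion K)ˣ) (g : G),
      f (w₀ * u x * g) = C₀ * (((ν x)⁻¹ : ℂˣ) : ℂ) * ((normAbs (w.adicCompletion K) (x : w.adicCompletion K) : ℝ) : ℂ) ^ (-e) *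
        f (ū ((x⁻¹ : (w.adicCompletion K)ˣ) : w.adicCompletion K) * g))
    (ψ : AddChar (w.adicCompletion K) Circle) {mψ : ℤ} (hmψ : ψ.HasConductorExp mψ) {σ : w.adicCompletion K} {j : ℤ}
    (hj : normAbs (w.adicCompletion K) σ = (residueFieldCard (w.adicCompletion K) : ℝ≥0)⁻¹ ^ j)
    (y : G) (m₀ : ℕ)
    (hmu : ∀ t ∈ primePowBall (w.adicCompletion K) (m₀ : ℤ), y⁻¹ * u t * y ∈ K')
    (hmū : ∀ t ∈ primePowBall (w.adicCompletion K) (m₀ : ℤ), y⁻¹ * ū t * y ∈ K')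
    (k k' : ℕ) (hk : max m₀ (max (mψ - j).toNat (j - mψ + 2 * (m₀ : ℤ) + 1).toNat) ≤ k)
    (hk' : max m₀ (max (mψ - j).toNat (j - mψ + 2 * (m₀ : ℤ) + 1).toNat) ≤ k') :
    ∫ x in primePowBall (w.adicCompletion K) (-(k : ℤ)), conj ((ψ (σ * x) : ℂ)) * f (w₀ * u x * y) ∂μ =
      ∫ x in primePowBall (w.adicCompletion K) (-(k' : ℤ)), conj ((ψ (σ * x) : ℂ)) * f (w₀ * u x * y) ∂μ := by
  obtain ⟨hσm, htail⟩ := thresholds_of_level ψ hmψ hj m₀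
  obtain ⟨R, -, hRinc, hRcov⟩ := exists_finset_primePowBall_eq_biUnion (F := w.adicCompletion K)
    (j := -((max m₀ (max (mψ - j).toNat (j - mψ + 2 * (m₀ : ℤ) + 1).toNat) : ℕ) : ℤ))
    (r := ((max m₀ (max (mψ - j).toNat (j - mψ + 2 * (m₀ : ℤ) + 1).toNat) : ℕ) : ℤ)) (by omega)
  rw [setIntegral_ball_twisted_eq_sum μ hfK hu_add w₀ ν e C₀ hrel ψ σ y m₀ _ (le_max_left _ _) hmu hmū hσm htail R hRinc hRcov k hk,
    setIntegral_ball_twisted_eq_sum μ hfK hu_add w₀ ν e C₀ hrel ψ σ y m₀ _ (le_max_left _ _) hmu hmū hσm htail R hRinc hRcov k' hk']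

end Fixed

/-! ## §2 Family form: ★ `exists_twisted_family_ball`'s `N`, the ball clause past the threshold of ANY caller's level -/

section Family

variable {K : Type} [Field K] [NumberField K] {w : HeightOneSpectrum (𝓞 K)} {G : Type*} [Group G] [TopologicalSpace G] [IsTopologicalGroup G]
variable [MeasurableSpace (w.adicCompletion K)] [BorelSpace (w.adicCompletion K)] (μ : Measure (w.adicCompletion K)) [μ.IsAddHaarMeasure]

/-- **THE TWISTED RANK-ONE STAGE, FAMILY FORM, BALL THRESHOLD BY FORMULA** — ★ `exists_twisted_family_ball`'s binders VERBATIM ⊢ its three clauses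
(i) (ii) (iii) VERBATIM for the same `N`, AND (iv): for every `g`, EVERY level `m₀` of `g` for `K′` (`∀ t ∈ 𝔭^{m₀}, g⁻¹ u(t) g ∈ K′ ∧ g⁻¹ ū(t) g ∈ K′`) and every
`j` with `‖σ‖ = q^{−j}`: at every `s` where `Φ_s` is right-`K′`-invariant and satisfies the `SL₂` relation,
`N s g = ∫_{x ∈ 𝔭^{−k}} conj ψ(σx)·Φ_s(w₀ u(x) g) dμ` for ALL `k ≥ M(m₀, j) := max m₀ (max (mψ − j)⁺ (j − mψ + 2m₀ + 1)⁺)` — the threshold the consumer computes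
from ITS level (letter (b) `hk₀` of ★ p864748's `hGnv` road). [cite: Casselman1980, §3 Thm. 3.1] [cite: CasselmanShalika1980, §2] [cite: Tate1950, §2.5] -/
theorem exists_twisted_family_ball_of_level (Φ : ℂ → G → ℂ) {K' : Subgroup G} (hK' : IsOpen (K' : Set G))
    (hΦK : ∀ s : ℂ, 1 < s.re → ∀ g, ∀ k ∈ K', Φ s (g * k) = Φ s g)
    {u ū : w.adicCompletion K → G} (hu : Continuous u) (hu0 : u 0 = 1) (hū : Continuous ū) (hū0 : ū 0 = 1) (hu_add : ∀ x t, u (x + t) = u x * u t) (w₀ : G)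
    (ν : (w.adicCompletion K)ˣ →* ℂˣ) (hν : ∀ x, ‖((ν x : ℂˣ) : ℂ)‖ = 1) (a : ℕ) (c : ℂ) (he : ∀ s : ℂ, 1 < s.re → 1 < ((a : ℂ) * s + c).re)
    (C₀ : ℂ → ℂ)
    (hrel : ∀ s : ℂ, 1 < s.re → ∀ (x : (w.adicCompletion K)ˣ) (g : G),
      Φ s (w₀ * u x * g) = C₀ s * (((ν x)⁻¹ : ℂˣ) : ℂ) * ((normAbs (w.adicCompletion K) (x : w.adicCompletion K) : ℝ) : ℂ) ^ (-((a : ℂ) * s + c)) *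
        Φ s (ū ((x⁻¹ : (w.adicCompletion K)ˣ) : w.adicCompletion K) * g))
    (ψ : AddChar (w.adicCompletion K) Circle) {mψ : ℤ} (hmψ : ψ.HasConductorExp mψ) {σ : w.adicCompletion K} (hσ : σ ≠ 0) :
    ∃ N : ℂ → G → ℂ,
      (∀ (q₀ : ℕ) (s₀ : ℂ) (g : G), (∀ g' : G, IsQRationalRegularAt q₀ s₀ fun s => Φ s g') → IsQRationalRegularAt q₀ s₀ fun s => N s g) ∧
      (∀ s : ℂ, 1 < s.re → ∀ g,
        Integrable (fun x => conj ((ψ (σ * x) : ℂ)) * Φ s (w₀ * u x * g)) μ ∧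
          ∫ x, conj ((ψ (σ * x) : ℂ)) * Φ s (w₀ * u x * g) ∂μ = N s g) ∧
      (∀ g : G, ∃ k₀ : ℕ, ∀ s : ℂ, (∀ g', ∀ k ∈ K', Φ s (g' * k) = Φ s g') →
        (∀ (x : (w.adicCompletion K)ˣ) (g' : G),
          Φ s (w₀ * u x * g') = C₀ s * (((ν x)⁻¹ : ℂˣ) : ℂ) * ((normAbs (w.adicCompletion K) (x : w.adicCompletion K) : ℝ) : ℂ) ^ (-((a : ℂ) * s + c)) *
            Φ s (ū ((x⁻¹ : (w.adicCompletion K)ˣ) : w.adicCompletion K) * g')) →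
        ∀ k : ℕ, k₀ ≤ k → N s g = ∫ x in primePowBall (w.adicCompletion K) (-(k : ℤ)), conj ((ψ (σ * x) : ℂ)) * Φ s (w₀ * u x * g) ∂μ) ∧
      ∀ (g : G) (m₀ : ℕ), (∀ t ∈ primePowBall (w.adicCompletion K) (m₀ : ℤ), g⁻¹ * u t * g ∈ K') →
        (∀ t ∈ primePowBall (w.adicCompletion K) (m₀ : ℤ), g⁻¹ * ū t * g ∈ K') →
        ∀ j : ℤ, normAbs (w.adicCompletion K) σ = (residueFieldCard (w.adicCompletion K) : ℝ≥0)⁻¹ ^ j →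
        ∀ s : ℂ, (∀ g', ∀ k ∈ K', Φ s (g' * k) = Φ s g') →
        (∀ (x : (w.adicCompletion K)ˣ) (g' : G),
          Φ s (w₀ * u x * g') = C₀ s * (((ν x)⁻¹ : ℂˣ) : ℂ) * ((normAbs (w.adicCompletion K) (x : w.adicCompletion K) : ℝ) : ℂ) ^ (-((a : ℂ) * s + c)) *
            Φ s (ū ((x⁻¹ : (w.adicCompletion K)ˣ) : w.adicCompletion K) * g')) →
        ∀ k : ℕ, max m₀ (max (mψ - j).toNat (j - mψ + 2 * (m₀ : ℤ) + 1).toNat) ≤ k →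
          N s g = ∫ x in primePowBall (w.adicCompletion K) (-(k : ℤ)), conj ((ψ (σ * x) : ℂ)) * Φ s (w₀ * u x * g) ∂μ := by
  obtain ⟨N, hreg, hval, hball⟩ := exists_twisted_family_ball μ Φ hK' hΦK hu hu0 hū hū0 hu_add w₀ ν hν a c he C₀ hrel ψ hmψ hσ
  refine ⟨N, hreg, hval, hball, fun g m₀ hmu hmū j hj s hK hrels k hk => ?_⟩
  obtain ⟨k₀, hk₀⟩ := hball g
  -- past ★'s own threshold the ball integral is `N s g`; past `M(m₀, j)` the ball integrals agree (§1)
  rw [hk₀ s hK hrels (max k k₀) (le_max_right _ _)]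
  exact setIntegral_ball_twisted_eq_setIntegral_of_level μ hK hu_add w₀ ν _ (C₀ s) hrels ψ hmψ hj g m₀ hmu hmū (max k k₀) k
    (hk.trans (le_max_left _ _)) hk

/-- **THE SAME AT EVERY REGULAR POINT** (continued families; the form the K1-a♮ chain consumes) — ★ `exists_twisted_family_ball_regular`'s binders VERBATIM ⊢ its
three clauses VERBATIM, AND (iv′): for every `g`, every caller's level `m₀` of `g` for `K′`, every `j` with `‖σ‖ = q^{−j}`, and every `s₀` at which all point
values `s ↦ Φ_s(g′)` and `s ↦ C₀(s)` are `q₀^{-s}`-rational and regular: `N s₀ g = ∫_{x ∈ 𝔭^{−k}} conj ψ(σx)·Φ_{s₀}(w₀ u(x) g) dμ` for all `k ≥ M(m₀, j)` — the two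
letters transferred from `1 < re s` by ★ `IsQRationalRegularAt.eq_of_eqOn_halfPlane` exactly as in ★'s proof. [cite: Casselman1980, §3 Thm. 3.1] [cite: KudlaSweet1997, §1] -/
theorem exists_twisted_family_ball_regular_of_level (Φ : ℂ → G → ℂ) {K' : Subgroup G} (hK' : IsOpen (K' : Set G))
    (hΦK : ∀ s : ℂ, 1 < s.re → ∀ g, ∀ k ∈ K', Φ s (g * k) = Φ s g)
    {u ū : w.adicCompletion K → G} (hu : Continuous u) (hu0 : u 0 = 1) (hū : Continuous ū) (hū0 : ū 0 = 1) (hu_add : ∀ x t, u (x + t) = u x * u t) (w₀ : G)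
    (ν : (w.adicCompletion K)ˣ →* ℂˣ) (hν : ∀ x, ‖((ν x : ℂˣ) : ℂ)‖ = 1) (a : ℕ) (c : ℂ) (he : ∀ s : ℂ, 1 < s.re → 1 < ((a : ℂ) * s + c).re)
    (C₀ : ℂ → ℂ)
    (hrel : ∀ s : ℂ, 1 < s.re → ∀ (x : (w.adicCompletion K)ˣ) (g : G),
      Φ s (w₀ * u x * g) = C₀ s * (((ν x)⁻¹ : ℂˣ) : ℂ) * ((normAbs (w.adicCompletion K) (x : w.adicCompletion K) : ℝ) : ℂ) ^ (-((a : ℂ) * s + c)) *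
        Φ s (ū ((x⁻¹ : (w.adicCompletion K)ˣ) : w.adicCompletion K) * g))
    (ψ : AddChar (w.adicCompletion K) Circle) {mψ : ℤ} (hmψ : ψ.HasConductorExp mψ) {σ : w.adicCompletion K} (hσ : σ ≠ 0)
    (q₀ d : ℕ) (hq₀ : 2 ≤ q₀) (hq : residueFieldCard (w.adicCompletion K) = q₀ ^ d) :
    ∃ N : ℂ → G → ℂ,
      (∀ (q₁ : ℕ) (s₀ : ℂ) (g : G), (∀ g' : G, IsQRationalRegularAt q₁ s₀ fun s => Φ s g') → IsQRationalRegularAt q₁ s₀ fun s => N s g) ∧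
      (∀ s : ℂ, 1 < s.re → ∀ g,
        Integrable (fun x => conj ((ψ (σ * x) : ℂ)) * Φ s (w₀ * u x * g)) μ ∧
          ∫ x, conj ((ψ (σ * x) : ℂ)) * Φ s (w₀ * u x * g) ∂μ = N s g) ∧
      (∀ g : G, ∃ k₀ : ℕ, ∀ s₀ : ℂ, (∀ g' : G, IsQRationalRegularAt q₀ s₀ fun s => Φ s g') → IsQRationalRegularAt q₀ s₀ C₀ →
        ∀ k : ℕ, k₀ ≤ k → N s₀ g = ∫ x in primePowBall (w.adicCompletion K) (-(k : ℤ)), conj ((ψ (σ * x) : ℂ)) * Φ s₀ (w₀ * u x * g) ∂μ) ∧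
      ∀ (g : G) (m₀ : ℕ), (∀ t ∈ primePowBall (w.adicCompletion K) (m₀ : ℤ), g⁻¹ * u t * g ∈ K') →
        (∀ t ∈ primePowBall (w.adicCompletion K) (m₀ : ℤ), g⁻¹ * ū t * g ∈ K') →
        ∀ j : ℤ, normAbs (w.adicCompletion K) σ = (residueFieldCard (w.adicCompletion K) : ℝ≥0)⁻¹ ^ j →
        ∀ s₀ : ℂ, (∀ g' : G, IsQRationalRegularAt q₀ s₀ fun s => Φ s g') → IsQRationalRegularAt q₀ s₀ C₀ →
        ∀ k : ℕ, max m₀ (max (mψ - j).toNat (j - mψ + 2 * (m₀ : ℤ) + 1).toNat) ≤ k →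
          N s₀ g = ∫ x in primePowBall (w.adicCompletion K) (-(k : ℤ)), conj ((ψ (σ * x) : ℂ)) * Φ s₀ (w₀ * u x * g) ∂μ := by
  obtain ⟨N, hreg, hval, hball, hlevel⟩ :=
    exists_twisted_family_ball_of_level μ Φ hK' hΦK hu hu0 hū hū0 hu_add w₀ ν hν a c he C₀ hrel ψ hmψ hσ
  -- the two letters at a regular point, transferred from the half-plane (★'s proof)
  have hKs : ∀ s₀ : ℂ, (∀ g' : G, IsQRationalRegularAt q₀ s₀ fun s => Φ s g') → ∀ g', ∀ k' ∈ K', Φ s₀ (g' * k') = Φ s₀ g' :=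
    fun s₀ hΦreg g' k' hk' => IsQRationalRegularAt.eq_of_eqOn_halfPlane hq₀ (hΦreg (g' * k')) (hΦreg g') 1 fun s hs => hΦK s hs g' k' hk'
  have hrels : ∀ s₀ : ℂ, (∀ g' : G, IsQRationalRegularAt q₀ s₀ fun s => Φ s g') → IsQRationalRegularAt q₀ s₀ C₀ →
      ∀ (x : (w.adicCompletion K)ˣ) (g' : G),
        Φ s₀ (w₀ * u x * g') = C₀ s₀ * (((ν x)⁻¹ : ℂˣ) : ℂ) * ((normAbs (w.adicCompletion K) (x : w.adicCompletion K) : ℝ) : ℂ) ^ (-((a : ℂ) * s₀ + c)) *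
          Φ s₀ (ū ((x⁻¹ : (w.adicCompletion K)ˣ) : w.adicCompletion K) * g') := fun s₀ hΦreg hC₀ x g' => by
    have hmono := isQRationalRegularAt_normAbs_cpow_neg_affine (K := K) (w := w) q₀ d hq (x := (x : w.adicCompletion K)) x.ne_zero a c s₀
    have hR : IsQRationalRegularAt q₀ s₀ fun s => C₀ s * (((ν x)⁻¹ : ℂˣ) : ℂ) *
        ((normAbs (w.adicCompletion K) (x : w.adicCompletion K) : ℝ) : ℂ) ^ (-((a : ℂ) * s + c)) *
          Φ s (ū ((x⁻¹ : (w.adicCompletion K)ˣ) : w.adicCompletion K) * g') :=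
      ((hC₀.mul (isQRationalRegularAt_const q₀ s₀ _)).mul hmono).mul (hΦreg _)
    exact IsQRationalRegularAt.eq_of_eqOn_halfPlane hq₀ (hΦreg _) hR 1 fun s hs => hrel s hs x g'
  refine ⟨N, hreg, hval, fun g => ?_, fun g m₀ hmu hmū j hj s₀ hΦreg hC₀ k hk => hlevel g m₀ hmu hmū j hj s₀ (hKs s₀ hΦreg) (hrels s₀ hΦreg hC₀) k hk⟩
  obtain ⟨k₀, hk₀⟩ := hball g
  exact ⟨k₀, fun s₀ hΦreg hC₀ k hk => hk₀ s₀ (hKs s₀ hΦreg) (hrels s₀ hΦreg hC₀) k hk⟩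

end Family

end Summit.HodgeConjecture.HodgeConjecture.Cruxes.HLiu418.K2LiuRankOneStageTwistedBallLevel

end
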